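import Summits.MatrixMultiplication.MatrixMultiplication.Theorems.AbelianSTPPCensusTAStatFDefs

/-!
# T_A static certificate, range `6780 … 6833` (t*-indexed linear checker with the k-member tree at `τ = 2371/1000`): kernel evaluation, the completeness of the bucket lists, volumes `5551 … 5750` (small volume chunks: the kernel recursion through the long low-`t` lists is bounded per theorem)

Cell mm-stpp (rung F-M1), tier T_A = «beat `2.371`, the record exponent (ADVXXZ'25 / DEK+26 rounded)»; checker in `AbelianSTPPCensusTAStatFDefs.lean`, table and bucket lists in `AbelianSTPPCensusTAStatFData.lean`
(pattern: theory g12's `AbelianSTPPCensusTAStatDDom*/DCk*.lean`).  `decide` with kernel reduction (standard axioms; no `native_decide`), `Elab.async false`;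
consumed by `TAStatF.checkV_sound` / `TAStatF.domV_sound` / `TAStatF.m2V_sound` in the leaf `AbelianSTPPCensusLeafTA6833Closed.lean`.
WHAT THIS IS NOT: arithmetic on shape lists only; no statement about STPP families or `ω`.
-/

set_option linter.dupNamespace false
set_option autoImplicit false
set_option Elab.async false

namespace Summit.MatrixMultiplication.MatrixMultiplication.Theorems.TAStatF

set_option maxHeartbeats 0 in
/-- Completeness chunk: every sorted candidate shape of the volumes `5551 … 5650` lies in the list of the bucket of its `a·b` (707 shapes). [original] -/
theorem m2c5551 : TAStatF.m2V 100 5551 = true := by decide +kernel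

set_option maxHeartbeats 0 in
/-- Completeness chunk: every sorted candidate shape of the volumes `5651 … 5750` lies in the list of the bucket of its `a·b` (710 shapes). [original] -/
theorem m2c5651 : TAStatF.m2V 100 5651 = true := by decide +kernel

end Summit.MatrixMultiplication.MatrixMultiplication.Theorems.TAStatF
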